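import Literature.Geometry.DiscreteGeometry.KissingContactCount
import Literature.Geometry.DiscreteGeometry.KissingUnitContactDegree
import HarnessLib

/-!
# The fan triangles of a kissing configuration as vertex triples: the local interface of the
# finite classification (Hales 2012, Theorem 3 / Lemma 8 — the data of the linear programs)

Topic `Literature/Geometry/DiscreteGeometry`; provefact brick for `Hales2012_contactGraphTame`
(`TameContactGraphs.lean`).  The fan-refined Delaunay triangulation of a finite set `X` of unit
vectors with `0 ∈ interior (conv X)` is indexed in `SphericalCodeHullFanSides.lean` by pairs
`(c, i)` (a facet normal and a fan index); its node equation (`SphericalCodeHullFanNodeSum.lean`),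
closed-surface property (`card_fanTriangles_filter_eq_two`), contact census
(`KissingContactCount.lean`: `≥ 23` contacts) and degree bound (`KissingUnitContactDegree.lean`:
`≤ 4` contacts at a point) are the hypotheses of the finite classification of contact graphs
(Hales's Theorem 3 with Lemma 8, by exhaustion over labelled triangulations and linear
programming in the angles).  A finite enumeration does not see facet normals: it sees TRIANGLES
AS THREE-ELEMENT VERTEX SETS, the angle of a triangle at a vertex, and which pairs are contacts.
This file re-indexes the interface accordingly (everything PROVED, no named facts):

* `fanTriSets X : Finset (Finset E3)` — the vertex sets of the fan triangles
  (`fanVerts_injOn`: `(c, i) ↦` vertex set is injective, so nothing is lost);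
  `card_fanTriSets` (`= 20` for twelve points), `card_eq_three_of_mem_fanTriSets`,
  `subset_of_mem_fanTriSets`;
* `card_filter_fanTriSets_eq_two` — **every side of a triangle lies in exactly two triangles**;
  `card_filter_fanTriSets_eq_two_of_contact` — **every contact pair is a side of exactly two
  triangles** (contacts are hull edges);
* `triAngleAt X t y` — the angle of the triangle `t` at `y` (`0` if `y ∉ t`),
  `triAngleAt_eq_angle` (`= ∠(perpTo y a, perpTo y b)` for `t = {y, a, b}`), and
  **`sum_triAngleAt` — the node equation `Σ_{t ∈ fanTriSets X} triAngleAt X t y = 2π`** for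
  every `y ∈ X`; `cos_triAngleAt_mul` (the spherical law of cosines for these angles);
* metric facts about the sides of a triangle of a twelve-point configuration with pairwise
  inner products `≤ 1/2`: `neg_half_lt_inner_of_mem_fanTriSets` (two vertices of a triangle
  have inner product `> −1/2`), and the **rhombus cap** `inner_nonneg_of_two_apexes`: a pair
  `{b, x}` that is a side of two triangles `{b, x, v}`, `{b, x, w}` whose other sides are all
  contacts has `⟪b, x⟫ ≥ 0` (the pairing lemma across a hull edge,
  `not_hasApex_and_hasApex`, or inside a facet, `inner_eq_zero_of_rhombus_tight`).

## References
* T. C. Hales, *A proof of Fejes Tóth's conjecture on sphere packings with kissing number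
  twelve*, arXiv:1209.6043 (2012), proof of Theorem 2 (the triangulated Delaunay polyhedron,
  the pairing of `(2,0,1)` regions), Lemma 9 (node equations). [`Hales2012`]
-/

noncomputable section

namespace Literature.Geometry.DiscreteGeometry

open Real RealInnerProductSpace InnerProductGeometry Finset

section FanTriSets

local notation "E3" => EuclideanSpace ℝ (Fin 3)

variable {X : Finset E3}

/-! ### Part A. The vertex sets of the fan triangles -/

/-- **The fan triangles as vertex triples**: the three-element sets
`{w 0, w (i+1), w (i+2)}` (`w = fVert X c`) over all facet normals `c` and fan indices
`i + 2 < m_c`. [cite: Hales2012, proof of Theorem 2] -/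
def fanTriSets (X : Finset E3) : Finset (Finset E3) :=
  (fanTriangles X).image (fanVerts X)

/-- Membership in `fanTriSets`. [folklore] -/
theorem mem_fanTriSets {t : Finset E3} :
    t ∈ fanTriSets X ↔ ∃ p ∈ fanTriangles X, fanVerts X p = t := by
  unfold fanTriSets
  rw [Finset.mem_image]

/-- A fan triangle has three vertices. [folklore] -/
theorem card_eq_three_of_mem_fanTriSets (hX1 : ∀ y ∈ X, ‖y‖ = 1) {t : Finset E3}
    (ht : t ∈ fanTriSets X) : t.card = 3 := by
  obtain ⟨p, hp, rfl⟩ := mem_fanTriSets.1 ht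
  exact fanVerts_card hX1 hp

/-- The vertices of a fan triangle are points of `X`. [folklore] -/
theorem subset_of_mem_fanTriSets (hX1 : ∀ y ∈ X, ‖y‖ = 1) {t : Finset E3}
    (ht : t ∈ fanTriSets X) : t ⊆ X := by
  obtain ⟨p, hp, rfl⟩ := mem_fanTriSets.1 ht
  exact (fanVerts_subset_tightSet hX1 hp).trans (tightSet_subset X p.1)

/-- The vertices of a fan triangle lie on a common facet. [folklore] -/
theorem exists_subset_tightSet_of_mem_fanTriSets (hX1 : ∀ y ∈ X, ‖y‖ = 1) {t : Finset E3}
    (ht : t ∈ fanTriSets X) : ∃ c ∈ facetNormals X, t ⊆ tightSet X c := by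
  obtain ⟨p, hp, rfl⟩ := mem_fanTriSets.1 ht
  exact ⟨p.1, (mem_fanTriangles.1 hp).1, fanVerts_subset_tightSet hX1 hp⟩

/-- **The indexing `(c, i) ↦ {w 0, w (i+1), w (i+2)}` of the fan triangles is injective**:
three common vertices force a common facet (`eq_of_three_mem_tightSet`), and inside a facet
the apex `w 0` and the two further vertices determine the fan index. [folklore] -/
theorem fanVerts_injOn (hX1 : ∀ y ∈ X, ‖y‖ = 1) :
    Set.InjOn (fanVerts X) (fanTriangles X : Set (E3 × ℕ)) := by
  rintro ⟨c, i⟩ hp ⟨c', j⟩ hq h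
  have hp' := mem_fanTriangles.1 (Finset.mem_coe.1 hp)
  have hq' := mem_fanTriangles.1 (Finset.mem_coe.1 hq)
  simp only at hp' hq'
  have hsub := fanVerts_subset_tightSet hX1 (Finset.mem_coe.1 hp)
  have hsub' := fanVerts_subset_tightSet hX1 (Finset.mem_coe.1 hq)
  simp only at hsub hsub'
  -- the three vertices of `p`
  have h0 : fVert X c 0 ∈ fanVerts X (c, i) := by
    unfold fanVerts; exact Finset.mem_insert_self _ _
  have h1 : fVert X c (i + 1) ∈ fanVerts X (c, i) := by
    unfold fanVerts
    exact Finset.mem_insert_of_mem (Finset.mem_insert_self _ _)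
  have h2 : fVert X c (i + 2) ∈ fanVerts X (c, i) := by
    unfold fanVerts
    exact Finset.mem_insert_of_mem (Finset.mem_insert_of_mem (Finset.mem_singleton_self _))
  have n01 : fVert X c 0 ≠ fVert X c (i + 1) :=
    fVert_ne_of_ne hX1 hp'.1 (by omega) (by omega) (by omega)
  have n02 : fVert X c 0 ≠ fVert X c (i + 2) :=
    fVert_ne_of_ne hX1 hp'.1 (by omega) hp'.2 (by omega)
  have n12 : fVert X c (i + 1) ≠ fVert X c (i + 2) :=
    fVert_ne_of_ne hX1 hp'.1 (by omega) hp'.2 (by omega)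
  have hcc : c = c' :=
    eq_of_three_mem_tightSet hX1 hp'.1 (hsub h0) (hsub h1) (hsub h2)
      (hsub' (h ▸ h0)) (hsub' (h ▸ h1)) (hsub' (h ▸ h2)) n01 n02 n12
  subst hcc
  -- inside the facet: the indices agree
  have hq1 : fVert X c (j + 1) ∈ fanVerts X (c, i) := by
    rw [h]; unfold fanVerts
    exact Finset.mem_insert_of_mem (Finset.mem_insert_self _ _)
  have hq2 : fVert X c (j + 2) ∈ fanVerts X (c, i) := by
    rw [h]; unfold fanVerts
    exact Finset.mem_insert_of_mem (Finset.mem_insert_of_mem (Finset.mem_singleton_self _))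
  unfold fanVerts at hq1 hq2
  simp only [Finset.mem_insert, Finset.mem_singleton] at hq1 hq2
  have hinj : ∀ {a b : ℕ}, a < (tightSet X c).card → b < (tightSet X c).card →
      fVert X c a = fVert X c b → a = b := by
    intro a b ha hb hab
    by_contra hne
    exact fVert_ne_of_ne hX1 hp'.1 ha hb hne hab
  have hij : i = j := by
    rcases hq1 with e | e | e
    · exact absurd (hinj (by omega) (by omega) e) (by omega)
    · have := hinj (by omega) (by omega) e; omega
    · have e1 := hinj (by omega) (by omega) e
      rcases hq2 with f | f | f
      · exact absurd (hinj (by omega) (by omega) f) (by omega)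
      · have := hinj (by omega) (by omega) f; omega
      · have := hinj (by omega) hp'.2 f; omega
  rw [hij]

/-- **There are twenty fan triangles** for twelve unit vectors with `0` inside their hull
(Legendre's count, `card_fanTriangles`). [cite: Hales2012, proof of Theorem 2] -/
theorem card_fanTriSets (h12 : X.card = 12) (hX1 : ∀ y ∈ X, ‖y‖ = 1)
    (h0 : (0 : E3) ∈ interior (convexHull ℝ (X : Set E3))) : (fanTriSets X).card = 20 := by
  unfold fanTriSets
  rw [Finset.card_image_of_injOn (fanVerts_injOn hX1), card_fanTriangles_eq_sum]
  exact card_fanTriangles h12 hX1 h0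

/-! ### Part B. Two triangles on every side; contacts are sides -/

/-- Filtering the vertex triples containing `s` is the image of filtering the fan triangles.
[folklore] -/
theorem filter_fanTriSets_eq_image (s : Finset E3) :
    (fanTriSets X).filter (fun t => s ⊆ t) =
      ((fanTriangles X).filter fun q => s ⊆ fanVerts X q).image (fanVerts X) := by
  unfold fanTriSets
  rw [Finset.filter_image]

/-- The number of vertex triples containing `s` is the number of fan triangles containing `s`.
[folklore] -/
theorem card_filter_fanTriSets (hX1 : ∀ y ∈ X, ‖y‖ = 1) (s : Finset E3) :
    ((fanTriSets X).filter (fun t => s ⊆ t)).card =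
      ((fanTriangles X).filter fun q => s ⊆ fanVerts X q).card := by
  rw [filter_fanTriSets_eq_image]
  exact Finset.card_image_of_injOn fun p hp q hq h =>
    fanVerts_injOn hX1 (Finset.mem_coe.2 (Finset.mem_filter.1 (Finset.mem_coe.1 hp)).1)
      (Finset.mem_coe.2 (Finset.mem_filter.1 (Finset.mem_coe.1 hq)).1) h

/-- **Every side of a fan triangle lies in exactly two fan triangles** (the closed-surface
property of the fan-refined hull triangulation, `card_fanTriangles_filter_eq_two`, in
vertex-set form). [folklore] -/
theorem card_filter_fanTriSets_eq_two (hX1 : ∀ y ∈ X, ‖y‖ = 1)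
    (h0 : (0 : E3) ∈ interior (convexHull ℝ (X : Set E3))) {t : Finset E3}
    (ht : t ∈ fanTriSets X) {s : Finset E3} (hs : s ⊆ t) (h2 : s.card = 2) :
    ((fanTriSets X).filter (fun t' => s ⊆ t')).card = 2 := by
  obtain ⟨p, hp, rfl⟩ := mem_fanTriSets.1 ht
  rw [card_filter_fanTriSets hX1]
  exact card_fanTriangles_filter_eq_two hX1 h0 hp hs h2

/-- **A hull edge is a side of exactly two fan triangles** (one in each of its two facets).
[folklore] -/
theorem card_filter_fanTriSets_eq_two_of_mem_hullEdges (hX1 : ∀ y ∈ X, ‖y‖ = 1)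
    (h0 : (0 : E3) ∈ interior (convexHull ℝ (X : Set E3))) {s : Finset E3}
    (hs : s ∈ hullEdges X) : ((fanTriSets X).filter (fun t' => s ⊆ t')).card = 2 := by
  rw [card_filter_fanTriSets hX1, card_filter_fanTriangles_eq_sum]
  exact sum_countInFacet_of_mem_hullEdges hX1 h0 hs

/-- **Every contact pair is a side of exactly two fan triangles**: for a finite set of unit
vectors with pairwise inner products `≤ κ` (`κ > −1`), a pair at inner product exactly `κ`
spans a hull edge (`pair_mem_hullEdges_of_contact`). [cite: Hales2012, proof of Theorem 2] -/
theorem card_filter_fanTriSets_eq_two_of_contact (hX1 : ∀ y ∈ X, ‖y‖ = 1)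
    (h0 : (0 : E3) ∈ interior (convexHull ℝ (X : Set E3))) {κ : ℝ} (hκ : -1 < κ)
    (hXκ : ∀ u ∈ X, ∀ v ∈ X, u ≠ v → ⟪u, v⟫ ≤ κ) {u v : E3} (hu : u ∈ X) (hv : v ∈ X)
    (hne : u ≠ v) (huv : ⟪u, v⟫ = κ) :
    ((fanTriSets X).filter (fun t' => ({u, v} : Finset E3) ⊆ t')).card = 2 :=
  card_filter_fanTriSets_eq_two_of_mem_hullEdges hX1 h0
    (pair_mem_hullEdges_of_contact hX1 hκ hXκ hu hv hne huv)

/-- In particular **every contact pair is a side of some fan triangle**. [folklore] -/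
theorem exists_mem_fanTriSets_of_contact (hX1 : ∀ y ∈ X, ‖y‖ = 1)
    (h0 : (0 : E3) ∈ interior (convexHull ℝ (X : Set E3))) {κ : ℝ} (hκ : -1 < κ)
    (hXκ : ∀ u ∈ X, ∀ v ∈ X, u ≠ v → ⟪u, v⟫ ≤ κ) {u v : E3} (hu : u ∈ X) (hv : v ∈ X)
    (hne : u ≠ v) (huv : ⟪u, v⟫ = κ) :
    ∃ t ∈ fanTriSets X, u ∈ t ∧ v ∈ t := by
  have h := card_filter_fanTriSets_eq_two_of_contact hX1 h0 hκ hXκ hu hv hne huv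
  obtain ⟨t, ht⟩ : ((fanTriSets X).filter (fun t' => ({u, v} : Finset E3) ⊆ t')).Nonempty := by
    rw [← Finset.card_pos, h]; norm_num
  rw [Finset.mem_filter] at ht
  exact ⟨t, ht.1, ht.2 (Finset.mem_insert_self _ _),
    ht.2 (Finset.mem_insert_of_mem (Finset.mem_singleton_self _))⟩

/-! ### Part C. The angle of a triangle at a vertex; the node equation -/

/-- **The angle of the (fan) triangle with vertex set `t` at the point `y`**: the fan angle
`fanAngleAt X c i y` of the fan triangle `(c, i)` whose vertex set is `t` (a sum over a
singleton by `fanVerts_injOn`; `0` if `t` is not a fan triangle or `y ∉ t`). [folklore] -/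
def triAngleAt (X : Finset E3) (t : Finset E3) (y : E3) : ℝ :=
  ∑ p ∈ (fanTriangles X).filter (fun p => fanVerts X p = t), fanAngleAt X p.1 p.2 y

/-- On a fan triangle `(c, i)` the vertex-set angle is the fan angle. [folklore] -/
theorem triAngleAt_fanVerts (hX1 : ∀ y ∈ X, ‖y‖ = 1) {p : E3 × ℕ} (hp : p ∈ fanTriangles X)
    (y : E3) : triAngleAt X (fanVerts X p) y = fanAngleAt X p.1 p.2 y := by
  unfold triAngleAt
  have hfilter : (fanTriangles X).filter (fun q => fanVerts X q = fanVerts X p) = {p} := by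
    ext q
    simp only [Finset.mem_filter, Finset.mem_singleton]
    constructor
    · rintro ⟨hq, h⟩
      exact fanVerts_injOn hX1 (Finset.mem_coe.2 hq) (Finset.mem_coe.2 hp) h
    · rintro rfl; exact ⟨hp, rfl⟩
  rw [hfilter, Finset.sum_singleton]

/-- The fan angle vanishes at a point that is not a vertex of the fan triangle. [folklore] -/
theorem fanAngleAt_eq_zero_of_not_mem {p : E3 × ℕ} {y : E3} (hy : y ∉ fanVerts X p) :
    fanAngleAt X p.1 p.2 y = 0 := by
  unfold fanVerts at hy
  simp only [Finset.mem_insert, Finset.mem_singleton, not_or] at hy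
  unfold fanAngleAt
  rw [if_neg hy.1, if_neg hy.2.1, if_neg hy.2.2]

/-- The vertex-set angle vanishes at a point outside the triangle. [folklore] -/
theorem triAngleAt_eq_zero_of_not_mem {t : Finset E3} {y : E3} (hy : y ∉ t) :
    triAngleAt X t y = 0 := by
  unfold triAngleAt
  refine Finset.sum_eq_zero fun p hp => ?_
  rw [Finset.mem_filter] at hp
  exact fanAngleAt_eq_zero_of_not_mem (by rw [hp.2]; exact hy)

/-- The vertex-set angle is nonnegative. [folklore] -/
theorem triAngleAt_nonneg (X : Finset E3) (t : Finset E3) (y : E3) : 0 ≤ triAngleAt X t y :=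
  Finset.sum_nonneg fun p _ => fanAngleAt_nonneg X p.1 p.2 y

/-- The vertex-set angle of a fan triangle is at most `π`. [folklore] -/
theorem triAngleAt_le_pi (hX1 : ∀ y ∈ X, ‖y‖ = 1) {t : Finset E3} (ht : t ∈ fanTriSets X)
    (y : E3) : triAngleAt X t y ≤ π := by
  obtain ⟨p, hp, rfl⟩ := mem_fanTriSets.1 ht
  rw [triAngleAt_fanVerts hX1 hp]
  exact fanAngleAt_le_pi X p.1 p.2 y

/-- The fan angles at `y`, summed over ALL fan triangles `(c, i)`, equal the double sum of
`sum_sum_fanAngleAt` over the facets containing `y` (the other facets contribute `0`).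
[folklore] -/
theorem sum_fanTriangles_fanAngleAt (hX1 : ∀ y ∈ X, ‖y‖ = 1) (y : E3) :
    ∑ p ∈ fanTriangles X, fanAngleAt X p.1 p.2 y =
      ∑ c ∈ facetsAt X y, ∑ i ∈ range ((tightSet X c).card - 2), fanAngleAt X c i y := by
  rw [Finset.sum_finset_product (fanTriangles X) (facetNormals X)
    (fun c => range ((tightSet X c).card - 2))
    (fun p => by
      rw [mem_fanTriangles, Finset.mem_range]
      constructor <;> rintro ⟨h1, h2⟩ <;> exact ⟨h1, by omega⟩)
    (f := fun p => fanAngleAt X p.1 p.2 y)]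
  -- the facets not containing `y` contribute nothing
  unfold facetsAt
  rw [← Finset.sum_filter_add_sum_filter_not (facetNormals X) (fun c => y ∈ tightSet X c)]
  conv_rhs => rw [← add_zero (∑ c ∈ (facetNormals X).filter (fun c => y ∈ tightSet X c),
    ∑ i ∈ range ((tightSet X c).card - 2), fanAngleAt X c i y)]
  congr 1
  refine Finset.sum_eq_zero fun c hc => Finset.sum_eq_zero fun i hi => ?_
  rw [Finset.mem_filter] at hc
  have hi' := Finset.mem_range.1 hi
  have hp : (c, i) ∈ fanTriangles X := mem_fanTriangles.2 ⟨hc.1, by simp only; omega⟩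
  refine fanAngleAt_eq_zero_of_not_mem (p := (c, i)) fun hy => hc.2 ?_
  exact fanVerts_subset_tightSet hX1 hp hy

/-- **The node equation in vertex-set form**: for `y ∈ X`, the angles at `y` of all fan
triangles (as vertex sets) sum to `2π`.
[cite: Hales2012, proof of Lemma 9 ("the angles around each node sum to 2π")] -/
theorem sum_triAngleAt (hX1 : ∀ y ∈ X, ‖y‖ = 1)
    (h0 : (0 : E3) ∈ interior (convexHull ℝ (X : Set E3))) {y : E3} (hy : y ∈ X) :
    ∑ t ∈ fanTriSets X, triAngleAt X t y = 2 * π := by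
  unfold triAngleAt fanTriSets
  rw [Finset.sum_fiberwise_of_maps_to (fun p hp => Finset.mem_image_of_mem _ hp),
    sum_fanTriangles_fanAngleAt hX1, sum_sum_fanAngleAt hX1 h0 hy]

/-- Two-element sets: `{a, b} = {a', b'}` forces `(a, b) = (a', b')` or `(a, b) = (b', a')`.
[folklore] -/
theorem pair_eq_pair_cases {a b a' b' : E3} (h : ({a, b} : Finset E3) = {a', b'}) :
    (a = a' ∧ b = b') ∨ (a = b' ∧ b = a') := by
  have ha : a ∈ ({a', b'} : Finset E3) := h ▸ Finset.mem_insert_self _ _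
  have hb : b ∈ ({a', b'} : Finset E3) := h ▸ Finset.mem_insert_of_mem (Finset.mem_singleton_self _)
  have ha' : a' ∈ ({a, b} : Finset E3) := h.symm ▸ Finset.mem_insert_self _ _
  have hb' : b' ∈ ({a, b} : Finset E3) :=
    h.symm ▸ Finset.mem_insert_of_mem (Finset.mem_singleton_self _)
  simp only [Finset.mem_insert, Finset.mem_singleton] at ha hb ha' hb'
  rcases ha with rfl | rfl
  · rcases hb with rfl | rfl
    · rcases hb' with h' | h'
      · exact Or.inl ⟨rfl, h'.symm⟩
      · exact Or.inl ⟨rfl, h'.symm⟩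
    · exact Or.inl ⟨rfl, rfl⟩
  · rcases hb with rfl | rfl
    · exact Or.inr ⟨rfl, rfl⟩
    · rcases ha' with h' | h'
      · exact Or.inr ⟨rfl, h'.symm⟩
      · exact Or.inr ⟨rfl, h'.symm⟩

/-- Removing the common apex: `{y, a, b} = {y, a', b'}` with `y ∉ {a, b, a', b'}` gives
`{a, b} = {a', b'}`. [folklore] -/
theorem pair_eq_of_triple_eq {y a b a' b' : E3} (h : ({y, a, b} : Finset E3) = {y, a', b'})
    (hya : y ≠ a) (hyb : y ≠ b) (hya' : y ≠ a') (hyb' : y ≠ b') :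
    ({a, b} : Finset E3) = {a', b'} := by
  have h1 : ({y, a, b} : Finset E3).erase y = {a, b} := by
    rw [Finset.erase_insert]
    simp only [Finset.mem_insert, Finset.mem_singleton, not_or]; exact ⟨hya, hyb⟩
  have h2 : ({y, a', b'} : Finset E3).erase y = {a', b'} := by
    rw [Finset.erase_insert]
    simp only [Finset.mem_insert, Finset.mem_singleton, not_or]; exact ⟨hya', hyb'⟩
  rw [← h1, ← h2, h]

/-- **The angle of a fan triangle `{y, a, b}` at `y` is the dihedral angle
`∠(perpTo y a, perpTo y b)`** (the angle between the tangent directions at `y` towards `a`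
and `b`, as in `sphExcess`). [folklore] -/
theorem triAngleAt_eq_angle (hX1 : ∀ y ∈ X, ‖y‖ = 1) {y a b : E3}
    (ht : ({y, a, b} : Finset E3) ∈ fanTriSets X) (hya : y ≠ a) (hyb : y ≠ b) :
    triAngleAt X {y, a, b} y = angle (perpTo y a) (perpTo y b) := by
  obtain ⟨⟨c, i⟩, hp, hpt⟩ := mem_fanTriSets.1 ht
  rw [← hpt, triAngleAt_fanVerts hX1 hp]
  have hp' := mem_fanTriangles.1 hp
  simp only at hp' ⊢
  have n01 : fVert X c 0 ≠ fVert X c (i + 1) :=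
    fVert_ne_of_ne hX1 hp'.1 (by omega) (by omega) (by omega)
  have n02 : fVert X c 0 ≠ fVert X c (i + 2) :=
    fVert_ne_of_ne hX1 hp'.1 (by omega) hp'.2 (by omega)
  have n12 : fVert X c (i + 1) ≠ fVert X c (i + 2) :=
    fVert_ne_of_ne hX1 hp'.1 (by omega) hp'.2 (by omega)
  unfold fanVerts at hpt
  simp only at hpt
  have hy : y ∈ ({fVert X c 0, fVert X c (i + 1), fVert X c (i + 2)} : Finset E3) :=
    hpt ▸ Finset.mem_insert_self _ _
  simp only [Finset.mem_insert, Finset.mem_singleton] at hy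
  unfold fanAngleAt
  rcases hy with rfl | rfl | rfl
  · rw [if_pos rfl]
    rcases pair_eq_pair_cases (pair_eq_of_triple_eq hpt.symm hya hyb n01 n02) with
      ⟨h1, h2⟩ | ⟨h1, h2⟩
    · rw [h1, h2]
    · rw [h1, h2, angle_comm]
  · rw [if_neg n01.symm, if_pos rfl]
    have hpt' : ({fVert X c (i + 1), fVert X c 0, fVert X c (i + 2)} : Finset E3) =
        {fVert X c (i + 1), a, b} := by rw [Finset.insert_comm, hpt]
    rcases pair_eq_pair_cases (pair_eq_of_triple_eq hpt' n01.symm n12 hya hyb) with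
      ⟨h1, h2⟩ | ⟨h1, h2⟩
    · rw [h1, h2]
    · rw [h1, h2, angle_comm]
  · rw [if_neg n02.symm, if_neg n12.symm, if_pos rfl]
    have hpt' : ({fVert X c (i + 2), fVert X c 0, fVert X c (i + 1)} : Finset E3) =
        {fVert X c (i + 2), a, b} := by
      rw [← hpt]
      ext z; simp only [Finset.mem_insert, Finset.mem_singleton]; tauto
    rcases pair_eq_pair_cases (pair_eq_of_triple_eq hpt' n02.symm n12.symm hya hyb) with
      ⟨h1, h2⟩ | ⟨h1, h2⟩
    · rw [h1, h2]
    · rw [h1, h2, angle_comm]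

/-- **The spherical law of cosines for the angle of a fan triangle**: for unit vectors,
`cos (triAngleAt X {y,a,b} y) · (‖perpTo y a‖ ‖perpTo y b‖) = ⟪a, b⟫ − ⟪y, a⟫ ⟪y, b⟫` with
`‖perpTo y a‖² = 1 − ⟪y, a⟫²` (`norm_perpTo_sq_of_norm_eq_one`). [folklore] -/
theorem cos_triAngleAt_mul (hX1 : ∀ y ∈ X, ‖y‖ = 1) {y a b : E3}
    (ht : ({y, a, b} : Finset E3) ∈ fanTriSets X) (hya : y ≠ a) (hyb : y ≠ b) :
    Real.cos (triAngleAt X {y, a, b} y) * (‖perpTo y a‖ * ‖perpTo y b‖) =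
      ⟪a, b⟫ - ⟪y, a⟫ * ⟪y, b⟫ := by
  rw [triAngleAt_eq_angle hX1 ht hya hyb]
  have hy : ‖y‖ = 1 := hX1 y (subset_of_mem_fanTriSets hX1 ht (Finset.mem_insert_self _ _))
  exact cos_angle_perpTo_mul hy a b

/-! ### Part D. Metric facts about the sides of the triangles (twelve points, inner products `≤ 1/2`) -/

/-- **Two vertices of a fan triangle have inner product `> −1/2`** (they lie on a common
facet, whose circle has angular radius `< 60°` for twelve points with pairwise inner products
`≤ 1/2`: `neg_half_lt_inner_of_tight`). [cite: Hales2012, proof of Theorem 2] -/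
theorem neg_half_lt_inner_of_mem_fanTriSets (h12 : X.card = 12) (hX1 : ∀ y ∈ X, ‖y‖ = 1)
    (hp : ∀ y ∈ X, ∀ y' ∈ X, y ≠ y' → ⟪y, y'⟫ ≤ 1 / 2) {t : Finset E3} (ht : t ∈ fanTriSets X)
    {a b : E3} (ha : a ∈ t) (hb : b ∈ t) : -1 / 2 < ⟪a, b⟫ := by
  obtain ⟨c, hc, htc⟩ := exists_subset_tightSet_of_mem_fanTriSets hX1 ht
  exact neg_half_lt_inner_of_tight h12 hX1 hp hc (htc ha) (htc hb)

/-- **The rhombus cap** (Hales's pairing of `(2,0,1)` regions, in vertex-set form): if a pair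
`{b, x}` is a side of two fan triangles `{b, x, v}` and `{b, x, w}` (`v ≠ w`) whose four other
sides are contacts (`⟪v, b⟫ = ⟪v, x⟫ = ⟪w, b⟫ = ⟪w, x⟫ = 1/2`), then `⟪b, x⟫ ≥ 0` — across a
hull edge the two facets cannot both have an apex over a very long edge
(`not_hasApex_and_hasApex`), and inside one facet the rhombus is a square
(`inner_eq_zero_of_rhombus_tight`).
[cite: Hales2012, proof of Theorem 2 ("we cannot have (r₁,s₁,t₁) = (r₂,s₂,t₂) = (2,0,1)")] -/
theorem inner_nonneg_of_two_apexes (hX1 : ∀ y ∈ X, ‖y‖ = 1) {b x v w : E3} (hbx : b ≠ x)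
    (hvw : v ≠ w) (htv : ({b, x, v} : Finset E3) ∈ fanTriSets X)
    (htw : ({b, x, w} : Finset E3) ∈ fanTriSets X) (hvb : ⟪v, b⟫ = 1 / 2)
    (hvx : ⟪v, x⟫ = 1 / 2) (hwb : ⟪w, b⟫ = 1 / 2) (hwx : ⟪w, x⟫ = 1 / 2) : 0 ≤ ⟪b, x⟫ := by
  obtain ⟨c₁, hc₁, h₁⟩ := exists_subset_tightSet_of_mem_fanTriSets hX1 htv
  obtain ⟨c₂, hc₂, h₂⟩ := exists_subset_tightSet_of_mem_fanTriSets hX1 htw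
  have hb₁ : b ∈ tightSet X c₁ := h₁ (Finset.mem_insert_self _ _)
  have hx₁ : x ∈ tightSet X c₁ := h₁ (Finset.mem_insert_of_mem (Finset.mem_insert_self _ _))
  have hv₁ : v ∈ tightSet X c₁ :=
    h₁ (Finset.mem_insert_of_mem (Finset.mem_insert_of_mem (Finset.mem_singleton_self _)))
  have hb₂ : b ∈ tightSet X c₂ := h₂ (Finset.mem_insert_self _ _)
  have hx₂ : x ∈ tightSet X c₂ := h₂ (Finset.mem_insert_of_mem (Finset.mem_insert_self _ _))
  have hw₂ : w ∈ tightSet X c₂ :=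
    h₂ (Finset.mem_insert_of_mem (Finset.mem_insert_of_mem (Finset.mem_singleton_self _)))
  have nb : ‖b‖ = 1 := hX1 b (mem_tightSet.1 hb₁).1
  have nx : ‖x‖ = 1 := hX1 x (mem_tightSet.1 hx₁).1
  have nv : ‖v‖ = 1 := hX1 v (mem_tightSet.1 hv₁).1
  have nw : ‖w‖ = 1 := hX1 w (mem_tightSet.1 hw₂).1
  by_cases hc : c₁ = c₂
  · subst hc
    exact le_of_eq (inner_eq_zero_of_rhombus_tight nv nw nb nx hvb hvx hwb hwx hvw hbx
      (mem_tightSet.1 hv₁).2 (mem_tightSet.1 hw₂).2 (mem_tightSet.1 hb₁).2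
      (mem_tightSet.1 hx₁).2).symm
  · by_contra hneg
    replace hneg : ⟪b, x⟫ < 0 := lt_of_not_ge hneg
    have selfb : ⟪b, b⟫ = 1 := by rw [real_inner_self_eq_norm_sq, nb, one_pow]
    have selfx : ⟪x, x⟫ = 1 := by rw [real_inner_self_eq_norm_sq, nx, one_pow]
    have hvbx : v ∉ ({b, x} : Finset E3) := by
      simp only [Finset.mem_insert, Finset.mem_singleton, not_or]
      constructor
      · rintro rfl; rw [selfb] at hvb; norm_num at hvb
      · rintro rfl; rw [selfx] at hvx; norm_num at hvx
    have hwbx : w ∉ ({b, x} : Finset E3) := by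
      simp only [Finset.mem_insert, Finset.mem_singleton, not_or]
      constructor
      · rintro rfl; rw [selfb] at hwb; norm_num at hwb
      · rintro rfl; rw [selfx] at hwx; norm_num at hwx
    refine not_hasApex_and_hasApex hX1 hc₁ hc hb₁ hx₁ hb₂ hx₂ hbx hneg ⟨?_, ?_⟩
    · refine ⟨v, hv₁, hvbx, fun y hy => ?_⟩
      simp only [Finset.mem_insert, Finset.mem_singleton] at hy
      rcases hy with rfl | rfl
      · exact hvb
      · exact hvx
    · refine ⟨w, hw₂, hwbx, fun y hy => ?_⟩
      simp only [Finset.mem_insert, Finset.mem_singleton] at hy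
      rcases hy with rfl | rfl
      · exact hwb
      · exact hwx

end FanTriSets

end Literature.Geometry.DiscreteGeometry

end
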